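import Summits.ResolutionOfSingularities.ResolutionOfSingularities.Theorems.PurelyInseparableDim4JointForestNormalised
import Summits.ResolutionOfSingularities.ResolutionOfSingularities.Theorems.PurelyInseparableDim4JointTreeRoot
import HarnessLib

/-!
# Purely inseparable four-folds: SURVIVORS of the other root members and of the isolated root points through the blow-up of the
# host (brick S3 (c) «joint point∘coordinate chains», part 42a = v3-lite-full, survivor package; cell `res-dim4-pi`)

[OURS · counted 0] (D-0157 DOOR 2; desk WORD #66 (4)(c), #74 (g), #99 (d); frame `PIDim4.TerminationImpliesOrderReduction`,
S3 (c) v3-lite; host item stmt-ResolutionOfSingularities-16155, helper). Nothing here proves resolution of singularities in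
dimension ≥ 4 / characteristic `p` — NOT here, not anywhere in this programme.

Part 38's root theorem has ONE host and nothing else at the root. To merge it with part 21 (several pairwise separated root
members, isolated root points) the OTHER members and the isolated points must be carried through the blow-up `π` of the host
`c₀`: they are disjoint from `c₀`, so they SURVIVE as preimages with all their node data (part 9/11's `member_survival_global`,
`member_survival_zigzag_shape`, part 4's `exists_zigzag_comap_controlledTransform_of_not_mem_support`) — the survivor half of
part 14/20's node step, run at the root. THIS FILE packages exactly that, keeping the host abstract (a closed `c₀` whose points
have `x_i − b₀_i ∈ 𝔭` (`i ∈ S₀`) and which contains every closed hypersurface point with those coordinates):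

* **`root_survivors_package`** — from `mem` (other members, part 21's hypotheses, separated from the host and from the waiting
  coordinates `{x_i = b₀_i + c_i (i ∈ T)}`) and the finiteness + point walks of the isolated root parameters: finite sets
  `survF` (closed members of `Bl_{c₀} 𝔸⁵`) and `surv` (closed points) with the node data of part 20 for the transformed marked
  ideal, pairwise disjoint / avoiding, every survivor member projecting OFF `c₀` and OFF the waiting coordinates, every
  survivor point likewise, `Acc` of each survivor pair, and the COVER: a closed order-`p` point of the blow-up off `c₀` whose
  image has no waiting coordinates lies in `surv` or on a member of `survF`.

AI-produced formalisation, weaker than expert review. bears_on: LADDER-RESOLUTION:D157-DOOR2 (res-dim4-pi · S3 (c) joint v3-lite-full).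
-/

set_option linter.dupNamespace false -- D-0017: single-problem summit path `Summit.<S>.<S>.…` by design

noncomputable section

open MvPolynomial Finset CategoryTheory AlgebraicGeometry Opposite TopologicalSpace
open AlgebraicGeometry.Scheme.IdealSheafData (ofIdealTop vanishingIdeal)

namespace Summit.ResolutionOfSingularities.ResolutionOfSingularities.Theorems.PIDim4

open Literature.AlgebraicGeometry.Resolution
open Literature.AlgebraicGeometry.Resolution.Hauser2010
open Literature.AlgebraicGeometry.Resolution.AffinePointBlowup (P A γ coord Wtop ξ)

namespace Equimultiple

section Survivors

variable {K : Type} [Field K] {p : ℕ} [hp : Fact p.Prime] [CharP K p]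

/-- **SURVIVOR PACKAGE AT THE BLOW-UP OF THE HOST.** See the module docstring. `Ce = 𝓘(c₀)`, `M₁` the transform of
`(z^p + F)·𝒪` under `Bl_{Ce}`; the other root members `mem` (part 21's hypotheses) are separated from the host coordinates `(b₀, S₀)`
and from every waiting coordinate set `(b₀ + c, T)`, `(j, c, T) ∈ Wt`; the isolated root parameters (order `p`, not on the host, not on
a waiting member, not on a member) are finitely many with well-founded finitely branching point walks.
[cite: BierstoneGrigorievMilmanWlodarczyk2011, Def. 3.1.3; §4 Step 2b] [cite: Hauser2010, §§F–G] [cite: StacksProject, Tag 02OS] -/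
theorem root_survivors_package [IsAlgClosed K] [DecidableEq K] (F : MvPolynomial (Fin 4) K) (hF : F ≠ 0)
    (hclean : Literature.Barriers.ResolutionOfSingularities.HauserPerlega.IsClean p F)
    (plan : State K → Finset (Fin 4) → Finset (Fin 4 × (Fin 4 → K) × Finset (Fin 4)))
    (leaves : State K → Finset (Fin 4) → Finset (Fin 4 × (Fin 4 → K)))
    (mem : Finset ((Fin 4 → K) × Finset (Fin 4)))
    (hmem : ∀ bS ∈ mem, IsPermissibleCentre p bS.2 (deletePthPowers p (PointBlowup.translate bS.1 F)) ∧
      (∀ q : State K × Finset (Fin 4),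
        Relation.ReflTransGen (fun q q' : State K × Finset (Fin 4) =>
          ∃ e ∈ plan q.1 q.2, q' = (CentreBlowup.step p q.2 e.1 e.2.1 q.1, e.2.2))
          ((⟨deletePthPowers p (PointBlowup.translate bS.1 F), 0, ∅⟩ : State K), bS.2) q →
        (∀ e ∈ plan q.1 q.2, e.1 ∈ q.2 ∧ e.2.1 e.1 = 0 ∧ q.2 ⊆ e.2.2 ∧
            CentreBlowup.IsEquimultiplePoint p q.2 e.1 e.2.1 q.1 ∧
            IsPermissibleCentre p e.2.2 (CentreBlowup.step p q.2 e.1 e.2.1 q.1).F) ∧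
        (∀ e ∈ plan q.1 q.2, ∀ e' ∈ plan q.1 q.2, e ≠ e' →
            (e.1 = e'.1 ∧ ∃ i ∈ e.2.2, i ∈ e'.2.2 ∧ e.2.1 i ≠ e'.2.1 i) ∨
            (e.1 ≠ e'.1 ∧ ((e'.2.1 e.1 = 0 ∧ e.1 ∈ e'.2.2) ∨ (e.2.1 e'.1 = 0 ∧ e'.1 ∈ e.2.2)))) ∧
        (∀ l ∈ leaves q.1 q.2, CentreBlowup.IsEquimultiplePoint p q.2 l.1 l.2 q.1 →
            Acc (fun s' s : State K => Edge p Finset.univ s s') (CentreBlowup.step p q.2 l.1 l.2 q.1) ∧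
            ∀ s' : State K, Relation.ReflTransGen (fun a e : State K => Edge p Finset.univ a e)
                (CentreBlowup.step p q.2 l.1 l.2 q.1) s' →
              {jb : Fin 4 × (Fin 4 → K) | jb.2 jb.1 = 0 ∧
                CentreBlowup.IsEquimultiplePoint p Finset.univ jb.1 jb.2 s'}.Finite) ∧
        (∀ (j' : Fin 4) (b' : Fin 4 → K), j' ∈ q.2 → b' j' = 0 → (∀ k ∈ q.2, k < j' → b' k = 0) →
            CentreBlowup.IsEquimultiplePoint p q.2 j' b' q.1 →
            (∃ e ∈ plan q.1 q.2, e.1 = j' ∧ ∀ i ∈ e.2.2, b' i = e.2.1 i) ∨ (j', b') ∈ leaves q.1 q.2)) ∧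
      Acc (fun q' q : State K × Finset (Fin 4) =>
          ∃ e ∈ plan q.1 q.2, q' = (CentreBlowup.step p q.2 e.1 e.2.1 q.1, e.2.2))
        ((⟨deletePthPowers p (PointBlowup.translate bS.1 F), 0, ∅⟩ : State K), bS.2))
    (hsep : ∀ bS ∈ mem, ∀ bS' ∈ mem, bS ≠ bS' → ∃ i ∈ bS.2, i ∈ bS'.2 ∧ bS.1 i ≠ bS'.1 i)
    (b₀ : Fin 4 → K) (S₀ : Finset (Fin 4)) (Wt : Finset (Fin 4 × (Fin 4 → K) × Finset (Fin 4)))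
    (hsep₀ : ∀ bS ∈ mem, ∃ i ∈ bS.2, i ∈ S₀ ∧ bS.1 i ≠ b₀ i)
    (hWsep : ∀ bS ∈ mem, ∀ wt ∈ Wt, ∃ i ∈ bS.2, i ∈ wt.2.2 ∧ bS.1 i ≠ b₀ i + wt.2.1 i)
    (c₀ : Closeds (P 4 K)) (Ce : (P 4 K).IdealSheafData) (hCe : Ce = vanishingIdeal c₀)
    (hin₀ : ∀ z : P 4 K, z ∈ (c₀ : Set (P 4 K)) → ∀ i ∈ S₀, (X i.succ - C (b₀ i) : A 4 K) ∈ z.asIdeal)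
    (hon₀ : ∀ z : P 4 K, IsClosed ({z} : Set (P 4 K)) → (1 : ℕ∞) ≤ idealOrder (hypSheaf p F) z →
      (∀ i ∈ S₀, (X i.succ - C (b₀ i) : A 4 K) ∈ z.asIdeal) → z ∈ (c₀ : Set (P 4 K)))
    (hsnc₀ : HasSNCWith ((⟨hypSheaf p F, [], p⟩ : MarkedIdeal (P 4 K)).boundary) Ce)
    (M₁ : MarkedIdeal (blowup Ce)) (hM₁ : M₁ = (⟨hypSheaf p F, [], p⟩ : MarkedIdeal (P 4 K)).transform (blowup.π Ce) Ce)
    (hroots : {b' : Fin 4 → K | (∀ d : Fin 4 →₀ ℕ, d ≠ 0 → d.degree < p →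
        coeff d (PointBlowup.translate b' F) = 0) ∧ (¬ ∀ i ∈ S₀, b' i = b₀ i) ∧
        (∀ wt ∈ Wt, ¬ ∀ i ∈ wt.2.2, b' i = b₀ i + wt.2.1 i) ∧ ∀ bS ∈ mem, ¬ ∀ i ∈ bS.2, b' i = bS.1 i}.Finite)
    (hwalk₀ : ∀ b' : Fin 4 → K, (∀ d : Fin 4 →₀ ℕ, d ≠ 0 → d.degree < p → coeff d (PointBlowup.translate b' F) = 0) →
      (¬ ∀ i ∈ S₀, b' i = b₀ i) → (∀ wt ∈ Wt, ¬ ∀ i ∈ wt.2.2, b' i = b₀ i + wt.2.1 i) →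
      (∀ bS ∈ mem, ¬ ∀ i ∈ bS.2, b' i = bS.1 i) →
      Acc (fun s' s : State K => Edge p Finset.univ s s')
          (⟨deletePthPowers p (PointBlowup.translate b' F), 0, ∅⟩ : State K) ∧
        ∀ s' : State K, Relation.ReflTransGen (fun a e : State K => Edge p Finset.univ a e)
            (⟨deletePthPowers p (PointBlowup.translate b' F), 0, ∅⟩ : State K) s' →
          {jb : Fin 4 × (Fin 4 → K) | jb.2 jb.1 = 0 ∧
            CentreBlowup.IsEquimultiplePoint p Finset.univ jb.1 jb.2 s'}.Finite) :
    ∃ (survF : Finset (Closeds (blowup Ce))) (cstS : Closeds (blowup Ce) → State K)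
      (ctrS : Closeds (blowup Ce) → Finset (Fin 4)) (surv : Finset (blowup Ce)) (stS : blowup Ce → State K),
      (∀ d ∈ survF, (cstS d).F ≠ 0 ∧
        Literature.Barriers.ResolutionOfSingularities.HauserPerlega.IsClean p (cstS d).F ∧
        IsPermissibleCentre p (ctrS d) (cstS d).F ∧
        Scheme.IsRegular (vanishingIdeal d).subscheme ∧ HasSNCWith M₁.boundary (vanishingIdeal d) ∧
        (∃ (Y : Scheme.{0}) (φ : Y ⟶ blowup Ce) (ψ : Y ⟶ P 4 K) (_ : IsOpenImmersion φ) (_ : IsOpenImmersion ψ),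
          M₁.ideal.comap φ = (hypSheaf p (cstS d).F).comap ψ ∧
          (vanishingIdeal d).comap φ =
            (AffineCoordBlowup.𝓘Λ 4 K (insert 0 (Fin.succ '' ((ctrS d : Finset (Fin 4)) : Set (Fin 4))))).comap ψ ∧
          (d : Set (blowup Ce)) ⊆ Set.range φ ∧
          (AffineCoordBlowup.CΛ 4 K (insert 0 (Fin.succ '' ((ctrS d : Finset (Fin 4)) : Set (Fin 4)))) : Set (P 4 K)) ⊆
            Set.range ψ ∧
          ∃ (idx : (blowup Ce).IdealSheafData → Fin 4) (cst_ : (blowup Ce).IdealSheafData → K),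
            (∀ D ∈ M₁.boundary,
              ((D.support : Set (blowup Ce)) ∩ φ '' (ψ ⁻¹'
                (AffineCoordBlowup.CΛ 4 K (insert 0 (Fin.succ '' ((ctrS d : Finset (Fin 4)) : Set (Fin 4)))) :
                  Set (P 4 K)))).Nonempty →
              D.comap φ = (ofIdealTop (Ideal.span {(γ 4 K).symm (X (idx D).succ + C (cst_ D))})).comap ψ ∧
                (idx D ∈ ctrS d → cst_ D = 0)) ∧
            (∀ D₁ ∈ M₁.boundary, ∀ D₂ ∈ M₁.boundary,
              ((D₁.support : Set (blowup Ce)) ∩ φ '' (ψ ⁻¹'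
                (AffineCoordBlowup.CΛ 4 K (insert 0 (Fin.succ '' ((ctrS d : Finset (Fin 4)) : Set (Fin 4)))) :
                  Set (P 4 K)))).Nonempty →
              ((D₂.support : Set (blowup Ce)) ∩ φ '' (ψ ⁻¹'
                (AffineCoordBlowup.CΛ 4 K (insert 0 (Fin.succ '' ((ctrS d : Finset (Fin 4)) : Set (Fin 4)))) :
                  Set (P 4 K)))).Nonempty →
              idx D₁ = idx D₂ → D₁ = D₂)) ∧
        (∀ q : State K × Finset (Fin 4),
          Relation.ReflTransGen (fun q q' : State K × Finset (Fin 4) =>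
            ∃ e ∈ plan q.1 q.2, q' = (CentreBlowup.step p q.2 e.1 e.2.1 q.1, e.2.2)) (cstS d, ctrS d) q →
          (∀ e ∈ plan q.1 q.2, e.1 ∈ q.2 ∧ e.2.1 e.1 = 0 ∧ q.2 ⊆ e.2.2 ∧
              CentreBlowup.IsEquimultiplePoint p q.2 e.1 e.2.1 q.1 ∧
              IsPermissibleCentre p e.2.2 (CentreBlowup.step p q.2 e.1 e.2.1 q.1).F) ∧
          (∀ e ∈ plan q.1 q.2, ∀ e' ∈ plan q.1 q.2, e ≠ e' →
              (e.1 = e'.1 ∧ ∃ i ∈ e.2.2, i ∈ e'.2.2 ∧ e.2.1 i ≠ e'.2.1 i) ∨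
              (e.1 ≠ e'.1 ∧ ((e'.2.1 e.1 = 0 ∧ e.1 ∈ e'.2.2) ∨ (e.2.1 e'.1 = 0 ∧ e'.1 ∈ e.2.2)))) ∧
          (∀ l ∈ leaves q.1 q.2, CentreBlowup.IsEquimultiplePoint p q.2 l.1 l.2 q.1 →
              Acc (fun s' s : State K => Edge p Finset.univ s s') (CentreBlowup.step p q.2 l.1 l.2 q.1) ∧
              ∀ s' : State K, Relation.ReflTransGen (fun a e : State K => Edge p Finset.univ a e)
                  (CentreBlowup.step p q.2 l.1 l.2 q.1) s' →
                {jb : Fin 4 × (Fin 4 → K) | jb.2 jb.1 = 0 ∧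
                  CentreBlowup.IsEquimultiplePoint p Finset.univ jb.1 jb.2 s'}.Finite) ∧
          (∀ (j' : Fin 4) (b' : Fin 4 → K), j' ∈ q.2 → b' j' = 0 → (∀ k ∈ q.2, k < j' → b' k = 0) →
              CentreBlowup.IsEquimultiplePoint p q.2 j' b' q.1 →
              (∃ e ∈ plan q.1 q.2, e.1 = j' ∧ ∀ i ∈ e.2.2, b' i = e.2.1 i) ∨ (j', b') ∈ leaves q.1 q.2)) ∧
        Acc (fun q' q : State K × Finset (Fin 4) =>
          ∃ e ∈ plan q.1 q.2, q' = (CentreBlowup.step p q.2 e.1 e.2.1 q.1, e.2.2)) (cstS d, ctrS d)) ∧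
      (∀ d ∈ survF, ∀ d' ∈ survF, d ≠ d' → Disjoint (d : Set (blowup Ce)) (d' : Set (blowup Ce))) ∧
      (∀ d ∈ survF, ∀ w ∈ (d : Set (blowup Ce)), blowup.π Ce w ∉ (c₀ : Set (P 4 K)) ∧
        ∀ wt ∈ Wt, ¬ ∀ i ∈ wt.2.2, (X i.succ - C (b₀ i + wt.2.1 i) : A 4 K) ∈ (blowup.π Ce w).asIdeal) ∧
      (∀ w ∈ surv, IsClosed ({w} : Set (blowup Ce)) ∧ (stS w).F ≠ 0 ∧
        Literature.Barriers.ResolutionOfSingularities.HauserPerlega.IsClean p (stS w).F ∧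
        (p : ℕ∞) ≤ CentreBlowup.ordAlong (Finset.univ : Finset (Fin 4)) (stS w).F ∧
        Acc (fun s' s : State K => Edge p Finset.univ s s') (stS w) ∧
        (∀ s' : State K, Relation.ReflTransGen (fun a b : State K => Edge p Finset.univ a b) (stS w) s' →
          {w' : blowup (Scheme.IdealSheafData.vanishingIdeal (AffinePointBlowup.C₀ 4 K)) |
            IsClosed ({w'} : Set (blowup (Scheme.IdealSheafData.vanishingIdeal (AffinePointBlowup.C₀ 4 K)))) ∧
            blowup.π (Scheme.IdealSheafData.vanishingIdeal (AffinePointBlowup.C₀ 4 K)) w' = ξ 4 K ∧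
            (p : ℕ∞) ≤ idealOrder ((⟨hypSheaf p s'.F, [], p⟩ : MarkedIdeal (P 4 K)).transform
              (blowup.π (Scheme.IdealSheafData.vanishingIdeal (AffinePointBlowup.C₀ 4 K)))
              (Scheme.IdealSheafData.vanishingIdeal (AffinePointBlowup.C₀ 4 K))).ideal w'}.Finite) ∧
        ∃ (Y : Scheme.{0}) (φ : Y ⟶ blowup Ce) (ψ : Y ⟶ P 4 K) (_ : IsOpenImmersion φ) (_ : IsOpenImmersion ψ) (y : Y),
          φ y = w ∧ ψ y = ξ 4 K ∧ M₁.ideal.comap φ = (hypSheaf p (stS w).F).comap ψ) ∧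
      (∀ w ∈ surv, blowup.π Ce w ∉ (c₀ : Set (P 4 K)) ∧
        (∀ wt ∈ Wt, ¬ ∀ i ∈ wt.2.2, (X i.succ - C (b₀ i + wt.2.1 i) : A 4 K) ∈ (blowup.π Ce w).asIdeal) ∧
        ∀ d ∈ survF, w ∉ (d : Set (blowup Ce))) ∧
      (∀ z : blowup Ce, IsClosed ({z} : Set (blowup Ce)) → (p : ℕ∞) ≤ idealOrder M₁.ideal z →
        blowup.π Ce z ∉ (c₀ : Set (P 4 K)) →
        (∀ wt ∈ Wt, ¬ ∀ i ∈ wt.2.2, (X i.succ - C (b₀ i + wt.2.1 i) : A 4 K) ∈ (blowup.π Ce z).asIdeal) →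
        z ∈ surv ∨ ∃ d ∈ survF, z ∈ (d : Set (blowup Ce))) := by
  classical
  haveI : PerfectRing K p := PerfectRing.ofSurjective K p fun x => IsAlgClosed.exists_pow_nat_eq x hp.out.pos
  set M₀ : MarkedIdeal (P 4 K) := ⟨hypSheaf p F, [], p⟩ with hM₀
  have hπ : IsBlowup (blowup.π Ce) Ce := blowup.isBlowup Ce
  haveI : IsProper (blowup.π Ce) := hπ.isProper
  haveI : IsLocallyNoetherian (blowup Ce) := LocallyOfFiniteType.isLocallyNoetherian (blowup.π Ce)
  have hCsupp : ∀ z : P 4 K, z ∉ (Ce.support : Set (P 4 K)) ↔ z ∉ (c₀ : Set (P 4 K)) := fun z => by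
    rw [hCe, Scheme.IdealSheafData.coe_support_vanishingIdeal]
  have hM₁I : M₁.ideal = controlledTransform (blowup.π Ce) Ce M₀.ideal M₀.mult := by rw [hM₁]; rfl
  -- a point whose coordinates agree with two separated parameter sets does not exist
  have hunit : ∀ (z : P 4 K) (i : Fin 4) (u v : K), (X i.succ - C u : A 4 K) ∈ z.asIdeal →
      (X i.succ - C v : A 4 K) ∈ z.asIdeal → u = v := by
    intro z i u v hu hv
    by_contra hne
    have h3 : (C (v - u) : A 4 K) ∈ z.asIdeal := by
      have h := z.asIdeal.sub_mem hu hv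
      rwa [sub_sub_sub_cancel_left, ← map_sub] at h
    exact z.2.ne_top (z.asIdeal.eq_top_of_isUnit_mem h3 ((isUnit_iff_ne_zero.mpr (sub_ne_zero.mpr (Ne.symm hne))).map C))
  -- the other root members
  let cof : (Fin 4 → K) × Finset (Fin 4) → Closeds (P 4 K) := fun bS =>
    if h : bS ∈ mem then (root_member_package (p := p) F bS.1 (hmem bS h).1).choose else ⊥
  have hcof : ∀ bS (h : bS ∈ mem), cof bS = (root_member_package (p := p) F bS.1 (hmem bS h).1).choose :=
    fun bS h => dif_pos h
  have hin : ∀ bS (h : bS ∈ mem), ∀ z : P 4 K, z ∈ (cof bS : Set (P 4 K)) → ∀ i ∈ bS.2, (X i.succ - C (bS.1 i) : A 4 K) ∈ z.asIdeal := by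
    intro bS h z hz
    rw [hcof bS h] at hz
    exact (root_member_package (p := p) F bS.1 (hmem bS h).1).choose_spec.2.2.2.1 z hz
  have hon : ∀ bS (h : bS ∈ mem), ∀ z : P 4 K, IsClosed ({z} : Set (P 4 K)) → (1 : ℕ∞) ≤ idealOrder (hypSheaf p F) z →
      (∀ i ∈ bS.2, (X i.succ - C (bS.1 i) : A 4 K) ∈ z.asIdeal) → z ∈ (cof bS : Set (P 4 K)) := by
    intro bS h z hzc hord hzS
    rw [hcof bS h]
    exact (root_member_package (p := p) F bS.1 (hmem bS h).1).choose_spec.2.2.2.2 z hzc hord hzS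
  have hcof_off₀ : ∀ bS (h : bS ∈ mem), Disjoint (cof bS : Set (P 4 K)) (Ce.support : Set (P 4 K)) := by
    intro bS h
    rw [hCe, Scheme.IdealSheafData.coe_support_vanishingIdeal, Set.disjoint_left]
    intro z hz hz₀
    obtain ⟨i, hi, hi₀, hne⟩ := hsep₀ bS h
    exact hne (hunit z i _ _ (hin bS h z hz i hi) (hin₀ z hz₀ i hi₀))
  have hcof_inj : ∀ bS (h : bS ∈ mem) bS' (h' : bS' ∈ mem), bS ≠ bS' → Disjoint (cof bS : Set (P 4 K)) (cof bS' : Set (P 4 K)) := by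
    intro bS h bS' h' hne
    obtain ⟨i, hi, hi', hb⟩ := hsep _ h _ h' hne
    exact Set.disjoint_left.mpr fun z hz hz' => hb (hunit z i _ _ (hin bS h z hz i hi) (hin bS' h' z hz' i hi'))
  have hcof_ne : ∀ bS (h : bS ∈ mem), (cof bS : Set (P 4 K)).Nonempty := by
    intro bS h
    have hspec := (root_member_package (p := p) F bS.1 (hmem bS h).1).choose_spec
    obtain ⟨-, -, ⟨Y, φ, ψ, _, _, -, hZ, hcφ, hsee⟩, -, -⟩ := hspec
    have hξ : (ξ 4 K) ∈ AffineCoordBlowup.CΛ 4 K (insert 0 (Fin.succ '' ((bS.2 : Finset (Fin 4)) : Set (Fin 4)))) := by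
      rw [AffineCoordBlowup.mem_CΛ_iff']
      intro i _
      exact (mem_originIdeal_iff K (4 + 1)).mpr (constantCoeff_X K i)
    obtain ⟨y, hy⟩ := hsee hξ
    refine ⟨φ y, ?_⟩
    rw [hcof bS h, ← coe_member_eq_image φ ψ _ hZ hcφ]
    exact ⟨y, by rw [Set.mem_preimage, hy]; exact hξ, rfl⟩
  -- survivors of the members
  set prei : (Fin 4 → K) × Finset (Fin 4) → Closeds (blowup Ce) := fun bS => (cof bS).preimage (blowup.π Ce).continuous
    with hprei
  have hprei_inj : ∀ bS ∈ mem, ∀ bS' ∈ mem, prei bS = prei bS' → bS = bS' := by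
    intro bS h bS' h' hee
    by_contra hne
    obtain ⟨x, hx⟩ := hcof_ne bS h
    obtain ⟨w, hw⟩ := exists_eq_of_not_mem_support hπ (Set.disjoint_left.mp (hcof_off₀ bS h) hx)
    have hw' : w ∈ (prei bS : Set (blowup Ce)) := by change blowup.π Ce w ∈ (cof bS : Set (P 4 K)); rw [hw]; exact hx
    rw [hee] at hw'
    exact Set.disjoint_left.mp (hcof_inj bS h bS' h' hne) hx (by rw [← hw]; exact hw')
  set survF : Finset (Closeds (blowup Ce)) := mem.image prei with hsurvF
  let rep : Closeds (blowup Ce) → (Fin 4 → K) × Finset (Fin 4) := fun d =>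
    if h : ∃ bS ∈ mem, prei bS = d then h.choose else ((0 : Fin 4 → K), (∅ : Finset (Fin 4)))
  have hrep : ∀ d ∈ survF, rep d ∈ mem ∧ prei (rep d) = d := by
    intro d hd
    have h : ∃ bS ∈ mem, prei bS = d := by simpa [hsurvF, Finset.mem_image] using hd
    have hr : rep d = h.choose := dif_pos h
    rw [hr]
    exact h.choose_spec
  set cstS : Closeds (blowup Ce) → State K := fun d => ⟨deletePthPowers p (PointBlowup.translate (rep d).1 F), 0, ∅⟩ with hcstS
  set ctrS : Closeds (blowup Ce) → Finset (Fin 4) := fun d => (rep d).2 with hctrS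
  -- the isolated root points and their survivors
  have hfin₀ : {z : P 4 K | IsClosed ({z} : Set (P 4 K)) ∧ (p : ℕ∞) ≤ idealOrder (hypSheaf p F) z ∧
      z ∉ (c₀ : Set (P 4 K)) ∧ (∀ wt ∈ Wt, ¬ ∀ i ∈ wt.2.2, (X i.succ - C (b₀ i + wt.2.1 i) : A 4 K) ∈ z.asIdeal) ∧
      ∀ bS ∈ mem, z ∉ (cof bS : Set (P 4 K))}.Finite := by
    let pt : (Fin (4 + 1) → K) → P 4 K := fun v => ⟨MvPolynomial.vanishingIdeal K {v}, inferInstance⟩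
    let g : (Fin 4 → K) → P 4 K := fun b => pt (Fin.cons ((frobeniusEquiv K p).symm (-MvPolynomial.eval b F)) b)
    refine (hroots.image g).subset fun z hz => ?_
    obtain ⟨hzc, hord, hz₀, hzW, hzoff⟩ := hz
    obtain ⟨a', b', hzab⟩ := exists_eq_vanishingIdeal_cons_of_isClosed hzc
    have hord' := (natCast_le_idealOrder_hypSheaf_iff (p := p) F hzab p).mp hord
    rw [natCast_le_ordZero_translate_hyp_iff] at hord'
    obtain ⟨hab, H⟩ := hord'
    have ha : (frobeniusEquiv K p).symm (-MvPolynomial.eval b' F) = a' := by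
      apply (frobeniusEquiv K p).injective
      rw [RingEquiv.apply_symm_apply, frobeniusEquiv_def]
      exact (eq_neg_of_add_eq_zero_left hab).symm
    have hord1 : (1 : ℕ∞) ≤ idealOrder (hypSheaf p F) z := le_trans (by exact_mod_cast hp.out.one_lt.le) hord
    refine ⟨b', ⟨H, fun hall => hz₀ (hon₀ z hzc hord1 fun i hi => (X_succ_sub_C_mem_asIdeal_iff i _ a' b' hzab).mpr (hall i hi)),
      fun wt hwt hall => hzW wt hwt fun i hi => (X_succ_sub_C_mem_asIdeal_iff i _ a' b' hzab).mpr (hall i hi),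
      fun bS hbS hall => hzoff bS hbS (hon bS hbS z hzc hord1
        fun i hi => (X_succ_sub_C_mem_asIdeal_iff i _ a' b' hzab).mpr (hall i hi))⟩, ?_⟩
    apply PrimeSpectrum.ext
    change MvPolynomial.vanishingIdeal K {(Fin.cons ((frobeniusEquiv K p).symm (-MvPolynomial.eval b' F)) b' :
      Fin (4 + 1) → K)} = z.asIdeal
    rw [ha, hzab]
  set pts₀ : Finset (P 4 K) := hfin₀.toFinset with hpts₀
  have hmem_pts₀ : ∀ z : P 4 K, z ∈ pts₀ ↔ IsClosed ({z} : Set (P 4 K)) ∧ (p : ℕ∞) ≤ idealOrder (hypSheaf p F) z ∧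
      z ∉ (c₀ : Set (P 4 K)) ∧ (∀ wt ∈ Wt, ¬ ∀ i ∈ wt.2.2, (X i.succ - C (b₀ i + wt.2.1 i) : A 4 K) ∈ z.asIdeal) ∧
      ∀ bS ∈ mem, z ∉ (cof bS : Set (P 4 K)) := fun z => by rw [hpts₀, Set.Finite.mem_toFinset, Set.mem_setOf_eq]
  have hpre : ∀ z : {z // z ∈ pts₀}, ∃ w : blowup Ce, blowup.π Ce w = z.1 := fun z =>
    exists_eq_of_not_mem_support hπ ((hCsupp z.1).mpr ((hmem_pts₀ z.1).mp z.2).2.2.1)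
  set pre : {z // z ∈ pts₀} → blowup Ce := fun z => (hpre z).choose with hpre_def
  have hπpre : ∀ z : {z // z ∈ pts₀}, blowup.π Ce (pre z) = z.1 := fun z => (hpre z).choose_spec
  set surv : Finset (blowup Ce) := pts₀.attach.image pre with hsurv_def
  have hmem_surv : ∀ w, w ∈ surv ↔ blowup.π Ce w ∈ pts₀ := by
    intro w
    rw [hsurv_def, Finset.mem_image]
    refine ⟨by rintro ⟨z, -, rfl⟩; rw [hπpre z]; exact z.2, fun hw => ⟨⟨blowup.π Ce w, hw⟩, Finset.mem_attach _ _,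
      eq_of_eq_of_not_mem_support hπ (hπpre _) (by rw [hπpre]; exact (hCsupp _).mpr ((hmem_pts₀ _).mp hw).2.2.1)⟩⟩
  set stS : blowup Ce → State K := fun w =>
    if hz : IsClosed ({blowup.π Ce w} : Set (P 4 K)) then
      ⟨deletePthPowers p (PointBlowup.translate (exists_eq_vanishingIdeal_cons_of_isClosed hz).choose_spec.choose F), 0, ∅⟩
    else ⟨F, 0, ∅⟩ with hstS
  refine ⟨survF, cstS, ctrS, surv, stS, fun d hd => ?_, fun d hd d' hd' hdd => ?_, fun d hd w hw => ?_, fun w hw => ?_,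
    fun w hw => ?_, fun z hz hzo hz₀ hzW => ?_⟩
  · -- data of a survivor member
    obtain ⟨hr, hcr⟩ := hrep d hd
    obtain ⟨hS, hplanc, haccc⟩ := hmem _ hr
    have hspec := (root_member_package (p := p) F (rep d).1 hS).choose_spec
    rw [← hcof _ hr] at hspec
    obtain ⟨hregc, hsncc, ⟨Yc, φc, ψc, _, _, hMc, hZc, hcφc, hseec⟩, -, -⟩ := hspec
    obtain ⟨hreg', -, hsnc'⟩ := member_survival_global hπ M₀ (cof (rep d)) (hcof_off₀ _ hr) hregc
      (coe_member_subset_support φc ψc M₀ rfl _ hMc hS.2 _ hZc hcφc) hsnc₀ hsncc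
    obtain ⟨Y', φ', ψ', _, _, hM', hZ', hcφ', hsee', idx₂, cst₂, hshape₂, hinj₂⟩ :=
      member_survival_zigzag_shape hπ (cof (rep d)) (hcof_off₀ _ hr) φc ψc M₀.ideal
        (hypSheaf p (deletePthPowers p (PointBlowup.translate (rep d).1 F))) hMc M₀.mult hZc
        hcφc hseec M₀.boundary (fun _ => 0) (fun _ => 0) (fun D hD => (List.not_mem_nil hD).elim)
        (fun D hD => (List.not_mem_nil hD).elim)
    have hcr' : (cof (rep d)).preimage (blowup.π Ce).continuous = d := hcr
    rw [hcr'] at hreg' hsnc' hZ' hcφ'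
    have hcst : cstS d = ⟨deletePthPowers p (PointBlowup.translate (rep d).1 F), 0, ∅⟩ := rfl
    have hctr : ctrS d = (rep d).2 := rfl
    rw [hcst, hctr, hM₁]
    exact ⟨deletePthPowers_translate_ne_zero hF hclean _, isClean_deletePthPowers _, hS, hreg', hsnc',
      ⟨Y', φ', ψ', inferInstance, inferInstance, hM', hZ', hcφ', hsee', idx₂, cst₂, hshape₂, hinj₂⟩, hplanc, haccc⟩
  · -- survivor members are pairwise disjoint
    obtain ⟨hr, hcr⟩ := hrep d hd
    obtain ⟨hr', hcr'⟩ := hrep d' hd'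
    have hne : rep d ≠ rep d' := fun h => hdd (by rw [← hcr, ← hcr', h])
    rw [← hcr, ← hcr']
    exact (hcof_inj _ hr _ hr' hne).preimage _
  · -- survivor members project off the host and off the waiting coordinates
    obtain ⟨hr, hcr⟩ := hrep d hd
    rw [← hcr] at hw
    change blowup.π Ce w ∈ (cof (rep d) : Set (P 4 K)) at hw
    refine ⟨fun h0 => ?_, fun wt hwt hall => ?_⟩
    · have hns : blowup.π Ce w ∉ (Ce.support : Set (P 4 K)) := fun hs => Set.disjoint_left.mp (hcof_off₀ _ hr) hw hs
      exact ((hCsupp _).mp hns) h0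
    obtain ⟨i, hi, hiT, hne⟩ := hWsep _ hr wt hwt
    exact hne (hunit _ i _ _ (hin _ hr _ hw i hi) (hall i hiT))
  · -- data of a survivor point
    have hz := (hmem_surv w).mp hw
    obtain ⟨hzc, hord, hz₀, hzW, hzoff⟩ := (hmem_pts₀ _).mp hz
    set a := (exists_eq_vanishingIdeal_cons_of_isClosed hzc).choose with ha
    set b := (exists_eq_vanishingIdeal_cons_of_isClosed hzc).choose_spec.choose with hb
    have hzab : (blowup.π Ce w).asIdeal = MvPolynomial.vanishingIdeal K {(Fin.cons a b : Fin (4 + 1) → K)} :=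
      (exists_eq_vanishingIdeal_cons_of_isClosed hzc).choose_spec.choose_spec
    have hstz : stS w = ⟨deletePthPowers p (PointBlowup.translate b F), 0, ∅⟩ := by rw [hstS]; exact dif_pos hzc
    have hord' := (natCast_le_idealOrder_hypSheaf_iff (p := p) F hzab p).mp hord
    rw [natCast_le_ordZero_translate_hyp_iff] at hord'
    obtain ⟨hab, H⟩ := hord'
    have hord1 : (1 : ℕ∞) ≤ idealOrder (hypSheaf p F) (blowup.π Ce w) := le_trans (by exact_mod_cast hp.out.one_lt.le) hord
    have hhost : ¬ ∀ i ∈ S₀, b i = b₀ i := fun hall =>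
      hz₀ (hon₀ _ hzc hord1 fun i hi => (X_succ_sub_C_mem_asIdeal_iff i _ a b hzab).mpr (hall i hi))
    have hwait : ∀ wt ∈ Wt, ¬ ∀ i ∈ wt.2.2, b i = b₀ i + wt.2.1 i := fun wt hwt hall =>
      hzW wt hwt fun i hi => (X_succ_sub_C_mem_asIdeal_iff i _ a b hzab).mpr (hall i hi)
    have hoff : ∀ bS ∈ mem, ¬ ∀ i ∈ bS.2, b i = bS.1 i := fun bS hbS hall =>
      hzoff bS hbS (hon bS hbS _ hzc hord1 fun i hi => (X_succ_sub_C_mem_asIdeal_iff i _ a b hzab).mpr (hall i hi))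
    obtain ⟨φ, _, hφ, hMφ⟩ := exists_chart_recenter (p := p) F a b hab hzab
    obtain ⟨hacc, hloc⟩ := hwalk₀ b H hhost hwait hoff
    have hnot : blowup.π Ce w ∉ (Ce.support : Set (P 4 K)) := (hCsupp _).mpr hz₀
    obtain ⟨Y', φ', ψ', _, _, y', hφ', hψ', hMw⟩ :=
      exists_zigzag_comap_controlledTransform_of_not_mem_support hπ hnot φ (𝟙 _) (ξ 4 K) hφ rfl M₀.ideal
        (hypSheaf p (deletePthPowers p (PointBlowup.translate b F))) (by rw [Scheme.IdealSheafData.comap_id]; exact hMφ)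
        M₀.mult (w := w) rfl
    rw [hstz]
    refine ⟨isClosed_singleton_of_not_mem_support hπ hzc hnot, deletePthPowers_translate_ne_zero hF hclean b,
      isClean_deletePthPowers _, ordAlong_univ_deletePthPowers_translate F b H, hacc, fun s' hs' => ?_, Y', φ', ψ',
      inferInstance, inferInstance, y', hφ', hψ', by rw [hM₁I]; exact hMw⟩
    exact finite_closedOver_model_of_finite_pairs s'
      (ordAlong_univ_of_reflTransGen_edge (ordAlong_univ_deletePthPowers_translate F b H) hs') (hloc s' hs')
  · -- survivor points avoid the host, the waiting coordinates and the survivor members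
    have hz := (hmem_surv w).mp hw
    obtain ⟨-, -, hz₀, hzW, hzoff⟩ := (hmem_pts₀ _).mp hz
    refine ⟨hz₀, hzW, fun d hd hwd => ?_⟩
    obtain ⟨hr, hcr⟩ := hrep d hd
    rw [← hcr] at hwd
    exact hzoff _ hr hwd
  · -- cover off the host and off the waiting coordinates
    have hnot : blowup.π Ce z ∉ (Ce.support : Set (P 4 K)) := (hCsupp _).mpr hz₀
    have hzo' : (p : ℕ∞) ≤ idealOrder (hypSheaf p F) (blowup.π Ce z) := by
      rw [← idealOrder_controlledTransform_eq_of_eq_of_not_mem_support hπ hnot M₀.ideal p rfl, ← hM₁I]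
      exact hzo
    have hzc : IsClosed ({blowup.π Ce z} : Set (P 4 K)) := isClosed_singleton_π' hπ hz
    by_cases h : ∃ bS ∈ mem, blowup.π Ce z ∈ (cof bS : Set (P 4 K))
    · obtain ⟨bS, hbS, hzb⟩ := h
      exact Or.inr ⟨prei bS, Finset.mem_image_of_mem prei hbS, hzb⟩
    · push Not at h
      exact Or.inl ((hmem_surv z).mpr ((hmem_pts₀ _).mpr ⟨hzc, hzo', hz₀, hzW, h⟩))

end Survivors

end Equimultiple

end Summit.ResolutionOfSingularities.ResolutionOfSingularities.Theorems.PIDim4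

end
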